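import Summits.KontsevichZagierPeriods.Zeta5Search.RVFlatGaugeZoneC
import Summits.KontsevichZagierPeriods.Zeta5Search.RVLargeParamZCoverMid
import HarnessLib.Audit
import HarnessLib

/-!
# RVFlatGaugePathForm — the flat `S₇`-gauge in CLASS-LAW FORM on the one-digit window: an identity, the path class law,
its proved zone (F1) and its reduced zone C (fam-rv gen 11, file 3)

HONEST FRAMING: systematic search; no irrationality claim unless certified.  `p`-adic valuations of rational numbers; nothing about
γ, measures or irrationality.  One statement minted by this cell appears, the node `PathClassLaw` (OBSERVED; by the theorems of this
file EQUIVALENT to FLAT ∧ (CV) on its window), stated as a named `Prop`, never assumed silently.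

THE IDENTITY (`Window.gauge_eq_cv_add_pathExcess`, unconditional).  On the one-digit window `D` = {`b` in the polytope, `p ≥ 5`,
`b₀ + 2 < p²`, `d(b) < p²`} Legendre has one digit on all 28 forms and on `d` (gen 8 `Cap.padicValRat_rhoB_midParams`:
`v_p ρ_B(c) = eSum − denSum − ⌊d/p⌋`; gen 7 `Window.pairFloors_eq_eSum_add`: `N_p = eSum + nonESum`), hence at EVERY labelling
  `−e_D♭(c) − v_p ρ_B(c) = (min(1,⌊d/p⌋) − N_p(c)) + pathExcess(c)`,  `pathExcess(c) := nonESum(c) + denSum(c) + max(⌊d/p⌋−1, 0) − e_D♭(c)`: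
the flat gauge of a labelling exceeds the class-law level by the FLOORS ALONG ONE HAMILTONIAN PATH of `K₇` — the six non-`E` pair
floors (pairs `(0,5),(0,6),(1,6),(2,4),(3,4),(3,5)` = the path `2–4–3–5–0–6–1`) plus the five denominator parameter floors (its
interior slots `{0,3,4,5,6}`) — plus the digit term, minus `e_D♭`.  A relabelling `σ ∈ S₇` moves the path; so the flat `S₇`-gauge law
for every `σ` is, orbit-wise, the CLASS LAW WITH THE PATH BONUS `max(pathExcess, 0)`: the node `PathClassLaw` (no zone hypothesis).
THEOREMS: `flat_of_pathClassLaw` (PathClassLaw ⇒ FLAT at every σ on `D`, by gen 9's transport `Cap.flat_of_perm28`);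
`pathClassLaw_of_flat_of_cv` (`FlatGaugeLaw` ∧ `CasoratianValuationLaw` ⇒ PathClassLaw); the zone edges
`flatGaugeLawZoneC_of_pathClassLaw`, `flatGaugeLawF1_of_pathClassLaw` (with `d < p²` discharged from the block structure:
`ZoneC.dOf_lt_sq`, `F1.dOf_lt_sq`); the PROVED ZONE `pathClassLaw_F1` (the inequality HOLDS on (F1) = {≤ one long block, `b₀ < 3p`},
from gen 10's `largeParamClassLaw_holds` and `flatGaugeLawF1_holds`); and `pathClassLaw_zoneC_of_twoLong` (on zone C the two-long class
law of file 2 implies it: `Γ ≥ pathExcess` is the budget `ZoneC.gauge_le_cv_zcGamma` read through the identity).  What a zone theorem adds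
to this form is only the SHAPE of `max_σ pathExcess(σb)`: `≤ lpBonus` on (F1) (gen 8 `gauge_le_cvplus`), `≤ Γ`, a function of one digit
type, on zone C (file 2; census: `=`); zones with `≥ 3` long blocks need no further reduction, only their shape
(`families/rv/FAMILY.md` §21.6 (31′)).
-/

namespace Summit.KontsevichZagierPeriods.Zeta5Search.RVFlatGauge

open Finset
open Summit.KontsevichZagierPeriods.Zeta5Search.CasoratianValuation (casoratian shift InPolytope pairFloors refund
  CasoratianValuationLaw)
open Summit.KontsevichZagierPeriods.Zeta5Search.WedgeDictionary (dOf Epairs)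
open Summit.KontsevichZagierPeriods.Zeta5Search.SymmetricGauge
open Summit.KontsevichZagierPeriods.Zeta5Search.DualSeries (InBox)
open Window Cap ZoneC

namespace Window

/-- **Floors along the labelling's Hamiltonian path**: the six non-`E` pair floors plus the five denominator parameter floors. -/
def pathFloors (c : ℕ → ℤ) (p : ℕ) : ℤ := nonESum c p + denSum c p

/-- **The per-labelling excess** `pathFloors + max(⌊d/p⌋ − 1, 0) − e_D♭`. -/
def pathExcess (c : ℕ → ℤ) (p : ℕ) : ℤ := pathFloors c p + max (dOf c / (p : ℤ) - 1) 0 - eDflat c p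

/-- **THE IDENTITY (one-digit window, unconditional):** `−e_D♭(c) − v_p ρ_B(c) = (min(1,⌊d/p⌋) − N_p(c)) + pathExcess(c)`. -/
theorem gauge_eq_cv_add_pathExcess {c : ℕ → ℤ} {p : ℕ} (hc : InPolytope c) (hp : p.Prime) (hp5 : 5 ≤ p)
    (hwin : (c 0 + 2 : ℤ) < (p : ℤ) ^ 2) (hd : dOf c < (p : ℤ) ^ 2) :
    -eDflat c p - padicValRat p (rhoB c) = (refund c p - pairFloors c p) + pathExcess c p := by
  have hp2 : p ≠ 2 := by omega
  have hval := padicValRat_rhoB_midParams hc hp hp2 hwin hd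
  have hpf := pairFloors_eq_eSum_add c p
  have hrefund : refund c p = min 1 (dOf c / (p : ℤ)) := rfl
  have hdig : min 1 (dOf c / (p : ℤ)) + max (dOf c / (p : ℤ) - 1) 0 = dOf c / (p : ℤ) := by
    rcases le_or_gt 1 (dOf c / (p : ℤ)) with h | h
    · rw [min_eq_left h, max_eq_left (by linarith)]; ring
    · rw [min_eq_right h.le, max_eq_right (by linarith)]; ring
  unfold pathExcess pathFloors
  rw [hval, hrefund, hpf]
  linarith

/-- `Σ_{k<7} (c₀ − 2c_k) = 7c₀ − 2 Σ_{k<7} c_k` (bookkeeping for the `d`-bounds). -/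
theorem sum_blocks_eq (c : ℕ → ℤ) : ∑ k ∈ range 7, (c 0 - 2 * c (k + 1)) = 7 * c 0 - 2 * ∑ k ∈ range 7, c (k + 1) := by
  rw [Finset.sum_sub_distrib, Finset.sum_const, card_range, ← Finset.mul_sum]
  simp

end Window

/-! ### The node: the class law with the path bonus -/

/-- **The path class law (one-digit window)** — OBSERVED, not proved in general: for `b` in the polytope, an admissible `e_j`, a prime
`p ≥ 5` with `b₀ + 2 < p²` and `d(b) < p²`:  `v_p(Casoratian_j(b)) ≥ min(1,⌊d/p⌋) − N_p(b) + max(pathExcess(b), 0)`.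
By `flat_of_pathClassLaw` / `pathClassLaw_of_flat_of_cv` it is EQUIVALENT to FLAT-for-every-σ ∧ (CV) on this window (`b` ranges
over whole `S₇`-orbits); it HOLDS on (F1) (`pathClassLaw_F1`, proved) and follows from `TwoLongClassLaw` on zone C. -/
@[conjecture] def PathClassLaw : Prop :=
  ∀ (b : ℕ → ℤ) (j p : ℕ), InPolytope b → 1 ≤ j → j ≤ 7 → InPolytope (shift b j) → p.Prime → 5 ≤ p →
    (b 0 + 2 : ℤ) < (p : ℤ) ^ 2 → dOf b < (p : ℤ) ^ 2 → casoratian b j ≠ 0 →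
    refund b p - pairFloors b p + max (pathExcess b p) 0 ≤ padicValRat p (casoratian b j)

/-- **PathClassLaw ⇒ FLAT for every relabelling** on the one-digit window (transport: gen 9's `Cap.flat_of_perm28`; the window is
`S₇`-stable because `b₀` and `d` are invariant). -/
theorem flat_of_pathClassLaw (h : PathClassLaw) (b : ℕ → ℤ) {j p : ℕ} (σ : Equiv.Perm (Fin 7)) (hb : InPolytope b)
    (hj1 : 1 ≤ j) (hj7 : j ≤ 7) (hb' : InPolytope (shift b j)) (hp : p.Prime) (hp5 : 5 ≤ p)
    (hwin : (b 0 + 2 : ℤ) < (p : ℤ) ^ 2) (hd : dOf b < (p : ℤ) ^ 2) (hcas : casoratian b j ≠ 0) :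
    -eDflat b p - padicValRat p (rhoB (permLower σ b)) ≤ padicValRat p (casoratian b j) := by
  have hbσ := inPolytope_permLower σ hb
  have hwin' : (permLower σ b 0 + 2 : ℤ) < (p : ℤ) ^ 2 := by rw [permLower_zero]; exact hwin
  have hd' : dOf (permLower σ b) < (p : ℤ) ^ 2 := by rw [dOf_permLower]; exact hd
  exact flat_of_perm28 b σ hj1 hj7 hb' hcas fun j' hj1' hj7' hshift hne => by
    rw [gauge_eq_cv_add_pathExcess hbσ hp hp5 hwin' hd']
    have := h (permLower σ b) j' p hbσ hj1' hj7' hshift hp hp5 hwin' hd' hne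
    have hm : pathExcess (permLower σ b) p ≤ max (pathExcess (permLower σ b) p) 0 := le_max_left _ _
    linarith

/-- The identity relabelling. -/
theorem permLower_one (b : ℕ → ℤ) : permLower 1 b = b := by
  funext i; unfold permLower; split_ifs with hi
  · simp only [Equiv.Perm.coe_one, id_eq]; congr 1; omega
  · rfl

/-- **Conversely, FLAT (the conjecture node `FlatGaugeLaw`, used at `σ = 1`) and (CV) give the path class law.** -/
theorem pathClassLaw_of_flat_of_cv (hF : FlatGaugeLaw) (hCV : CasoratianValuationLaw) : PathClassLaw := by
  intro b j p hb hj1 hj7 hb' hp hp5 hwin hd hcas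
  have hm1 : m1 b < (p : ℤ) ^ 2 := by have := Window.m1_le_b0_add_one hb; linarith
  have h1 := hF b j p 1 hb hj1 hj7 hb' hp hp5 hm1 hcas
  rw [permLower_one, gauge_eq_cv_add_pathExcess hb hp hp5 hwin hd] at h1
  have h2 := hCV b j p hb hj1 hj7 hb' hp hp5 hwin hcas
  rcases le_total (pathExcess b p) 0 with h0 | h0
  · rw [max_eq_right h0]; linarith
  · rw [max_eq_left h0]; linarith

/-! ### The two zones below `3p`: `d < p²` from the block structure, the edges, and (F1) as a proved zone -/

/-- ZONE C (two designated slots, the five other blocks short, `b₀ < 3p`): `d < 4p ≤ p²`. -/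
theorem ZoneC.dOf_lt_sq {c : ℕ → ℤ} {p : ℕ} (hc : InPolytope c) (hp5 : 5 ≤ p) (hc3 : c 0 < 3 * (p : ℤ)) {i₁ i₂ : ℕ}
    (hi₁ : i₁ < 7) (hi₂ : i₂ < 7) (hne : i₁ ≠ i₂) (hshort : ∀ k ∈ ((range 7).erase i₁).erase i₂, c 0 - 2 * c (k + 1) < p) :
    dOf c < (p : ℤ) ^ 2 := by
  have hp5' : (5 : ℤ) ≤ p := by exact_mod_cast hp5
  obtain ⟨⟨h00, hbox⟩, hhalf, hsum⟩ := id hc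
  have hnn : ∀ k, k < 7 → 0 ≤ c (k + 1) := fun k hk => (hbox k (mem_range.2 hk)).1
  have hmem₂ : i₂ ∈ (range 7).erase i₁ := mem_erase.2 ⟨hne.symm, mem_range.2 hi₂⟩
  have h5 : ∑ k ∈ ((range 7).erase i₁).erase i₂, (c 0 - 2 * c (k + 1)) ≤ 5 * ((p : ℤ) - 1) := by
    have h := Finset.sum_le_card_nsmul (((range 7).erase i₁).erase i₂) (fun k => c 0 - 2 * c (k + 1)) ((p : ℤ) - 1)
      (fun k hk => by
        have := hshort k hk
        show c 0 - 2 * c (k + 1) ≤ (p : ℤ) - 1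
        omega)
    rw [card_erase_of_mem hmem₂, card_erase_of_mem (mem_range.2 hi₁), card_range] at h
    simpa [nsmul_eq_mul] using h
  have hs₂ := Finset.sum_erase_eq_sub (f := fun k => c 0 - 2 * c (k + 1)) hmem₂
  have hs₁ := Finset.sum_erase_eq_sub (f := fun k => c 0 - 2 * c (k + 1)) (mem_range.2 hi₁)
  rw [hs₂, hs₁, Window.sum_blocks_eq] at h5
  have := hnn i₁ hi₁
  have := hnn i₂ hi₂
  have hd4 : dOf c < 4 * (p : ℤ) := by unfold dOf; linarith
  nlinarith

/-- (F1) (every block off the designated slot `i` short): `d < 4p ≤ p²` (`2d ≤ 7(p − 1) − c₀` or `≤ 6(p − 1)`; no `b₀`-window needed). -/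
theorem F1.dOf_lt_sq {c : ℕ → ℤ} {p : ℕ} (hc : InPolytope c) (hp5 : 5 ≤ p) {i : ℕ}
    (hshort : ∀ k ∈ (range 7).erase i, c 0 - 2 * c (k + 1) < p) : dOf c < (p : ℤ) ^ 2 := by
  have hp5' : (5 : ℤ) ≤ p := by exact_mod_cast hp5
  obtain ⟨⟨h00, hbox⟩, hhalf, hsum⟩ := id hc
  have hnn : ∀ k, k < 7 → 0 ≤ c (k + 1) := fun k hk => (hbox k (mem_range.2 hk)).1
  have hS : ∑ k ∈ (range 7).erase i, (c 0 - 2 * c (k + 1)) ≤ (((range 7).erase i).card : ℤ) * ((p : ℤ) - 1) := by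
    have h := Finset.sum_le_card_nsmul ((range 7).erase i) (fun k => c 0 - 2 * c (k + 1)) ((p : ℤ) - 1)
      (fun k hk => by
        have := hshort k hk
        show c 0 - 2 * c (k + 1) ≤ (p : ℤ) - 1
        omega)
    simpa [nsmul_eq_mul] using h
  have hcard : (((range 7).erase i).card : ℤ) ≤ 7 := by
    have := Finset.card_erase_le (s := range 7) (a := i)
    rw [card_range] at this
    exact_mod_cast this
  have hd4 : dOf c < 4 * (p : ℤ) := by
    by_cases hi : i < 7
    · have hs := Finset.sum_erase_eq_sub (f := fun k => c 0 - 2 * c (k + 1)) (mem_range.2 hi)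
      rw [hs, Window.sum_blocks_eq, card_erase_of_mem (mem_range.2 hi), card_range] at hS
      have := hnn i hi
      unfold dOf
      push_cast at hS
      linarith
    · have hni : i ∉ range 7 := fun h => hi (mem_range.1 h)
      rw [Finset.erase_eq_of_notMem hni, Window.sum_blocks_eq, card_range] at hS
      unfold dOf
      push_cast at hS
      linarith
  nlinarith

/-- `PathClassLaw ⇒ FlatGaugeLawZoneC`. -/
theorem flatGaugeLawZoneC_of_pathClassLaw (h : PathClassLaw) : FlatGaugeLawZoneC := by
  intro b j p i₁ i₂ σ hb hj1 hj7 hb' hp hp5 hb3 hi₁ hi₂ hne _ _ hshort hcas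
  exact flat_of_pathClassLaw h b σ hb hj1 hj7 hb' hp hp5 (win_of_lt_three_p hp5 hb3)
    (ZoneC.dOf_lt_sq hb hp5 hb3 hi₁ hi₂ hne hshort) hcas

/-- `PathClassLaw ⇒ FlatGaugeLawF1`. -/
theorem flatGaugeLawF1_of_pathClassLaw (h : PathClassLaw) : FlatGaugeLawF1 := by
  intro b j p i σ hb hj1 hj7 hb' hp hp5 hshort hb3 hcas
  exact flat_of_pathClassLaw h b σ hb hj1 hj7 hb' hp hp5 (win_of_lt_three_p hp5 hb3) (F1.dOf_lt_sq hb hp5 hshort) hcas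

/-- **The path class law HOLDS on (F1)** (≤ one long block, `b₀ < 3p`): gen 10's (CV⁺) `largeParamClassLaw_holds` (which contains
(CV), `lpBonus ≥ 0`) and `flatGaugeLawF1_holds` (FLAT, at `σ = 1`), assembled through the identity. -/
theorem pathClassLaw_F1 (b : ℕ → ℤ) {j p i : ℕ} (hb : InPolytope b) (hj1 : 1 ≤ j) (hj7 : j ≤ 7)
    (hb' : InPolytope (shift b j)) (hp : p.Prime) (hp5 : 5 ≤ p)
    (hshort : ∀ k ∈ (range 7).erase i, b 0 - 2 * b (k + 1) < p) (hb3 : b 0 < 3 * (p : ℤ)) (hcas : casoratian b j ≠ 0) :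
    refund b p - pairFloors b p + max (pathExcess b p) 0 ≤ padicValRat p (casoratian b j) := by
  have hwin := win_of_lt_three_p hp5 hb3
  have hd := F1.dOf_lt_sq hb hp5 hshort
  have h1 := flatGaugeLawF1_holds b j p i 1 hb hj1 hj7 hb' hp hp5 hshort hb3 hcas
  rw [permLower_one, gauge_eq_cv_add_pathExcess hb hp hp5 hwin hd] at h1
  have h2 := largeParamClassLaw_holds b j p i hb hj1 hj7 hb' hp hp5 hwin hshort hcas
  have h3 := lpBonus_nonneg b p
  rcases le_total (pathExcess b p) 0 with h0 | h0
  · rw [max_eq_right h0]; linarith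
  · rw [max_eq_left h0]; linarith

/-- On zone C the two-long class law (file 2) implies the path-class-law inequality: `Γ ≥ pathExcess` at the oriented labelling is
the budget `ZoneC.gauge_le_cv_zcGamma` read through the identity. -/
theorem pathClassLaw_zoneC_of_twoLong (h : TwoLongClassLaw) (b : ℕ → ℤ) {j p i₁ i₂ : ℕ} (hb : InPolytope b)
    (hj1 : 1 ≤ j) (hj7 : j ≤ 7) (hb' : InPolytope (shift b j)) (hp : p.Prime) (hp5 : 5 ≤ p) (hb3 : b 0 < 3 * (p : ℤ))
    (hi₁ : i₁ < 7) (hi₂ : i₂ < 7) (hne : i₁ ≠ i₂) (hL₁ : (p : ℤ) ≤ b 0 - 2 * b (i₁ + 1))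
    (hL₂ : (p : ℤ) ≤ b 0 - 2 * b (i₂ + 1)) (hle : b (i₁ + 1) ≤ b (i₂ + 1))
    (hshort : ∀ k ∈ ((range 7).erase i₁).erase i₂, b 0 - 2 * b (k + 1) < p) (hcas : casoratian b j ≠ 0) :
    refund b p - pairFloors b p + max (pathExcess b p) 0 ≤ padicValRat p (casoratian b j) := by
  have hnode := h b j p i₁ i₂ hb hj1 hj7 hb' hp hp5 hb3 hi₁ hi₂ hne hL₁ hL₂ hle hshort hcas
  have hbudget := ZoneC.gauge_le_cv_zcGamma b hb hp hp5 hb3 hi₁ hi₂ hne hL₁ hL₂ hle hshort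
  rw [gauge_eq_cv_add_pathExcess hb hp hp5 (win_of_lt_three_p hp5 hb3) (ZoneC.dOf_lt_sq hb hp5 hb3 hi₁ hi₂ hne hshort)]
    at hbudget
  have hB : max (pathExcess b p) 0 ≤ ZoneC.zcBonus b p i₁ i₂ := by
    unfold ZoneC.zcBonus
    exact max_le_max (by linarith) le_rfl
  linarith

end Summit.KontsevichZagierPeriods.Zeta5Search.RVFlatGauge
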